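import Literature.NumberTheory.LFunctions.KadiriNumericsRound1C
import Literature.NumberTheory.LFunctions.KadiriNumericsRound2C
import Literature.NumberTheory.LFunctions.KadiriNumericsRound3C
import Literature.NumberTheory.LFunctions.KadiriNumericsRound4C
import HarnessLib

/-!
# The large-height part of the Mossinghoff–Trudgian–Yang zero-free region, from the numerical verification of RH

Topic `Literature/NumberTheory/LFunctions`. Everything in this file is PROVED. It assembles the
tree's formalisation of Kadiri's method as run in Mossinghoff–Trudgian–Yang, *Res. Number Theory*
10 (2024) = arXiv:2212.06867, §9 (with the kernel `h^{(1)}_{1,θ}` of (9.2), the degree-16 polynomial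
of Mossinghoff–Trudgian 2015, Table 3, and the Riemann hypothesis up to height `3 000 175 332 800`
of Platt–Trudgian): starting from the tree's crude explicit region (constant `7062` above the
RH height, `KadiriStrip.hasOpenRegion_initial`), four rounds of the iteration `R ↦ r`

  `7062 → 6.4 → 5.66 → 5.57 → 5.558691`

(`KadiriNumerics.round_round1, …, round_round4`, each an instance of `KadiriStrip.strip_empty`
whose numerical hypotheses are certified in `KadiriNumericsRound{1,…,4}{A,B,C}.lean`) give the named
fact `zero_free_region_mossinghoff_trudgian_yang_large_height` (`ζ(σ + it) ≠ 0` for `t > 3·10¹²`,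
`σ ≥ 1 − 1/(5.558691 log t)`) from the named fact `platt_trudgian_numerical_rh` — the one input of
the printed proof that is a finite computation (Platt–Trudgian, *Bull. LMS* 53 (2021)).

## References

* M. J. Mossinghoff, T. S. Trudgian, A. Yang, arXiv:2212.06867, Theorem 1.3 and §9.
  (`MossinghoffTrudgianYangRNT2024`)
* M. J. Mossinghoff, T. S. Trudgian, J. Number Theory 157 (2015), §5. (`MossinghoffTrudgian2015`)
-/

noncomputable section

open Real

namespace Literature.NumberTheory.LFunctions

/-- `2 ≤ r log 2` for `r ≥ 3`. [folklore] -/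
theorem KadiriNumerics.two_le_mul_log_two {r : ℝ} (hr : 3 ≤ r) : 2 ≤ r * Real.log 2 := by
  have := Real.log_two_gt_d9; nlinarith

/-- `4480 + 74172/log H ≤ 7062` for `H = 3 000 175 332 800` (`log H ≥ log(3·10¹²) ≥ 28.7296`).
[cite: MossinghoffTrudgianYangRNT2024, §9] -/
theorem KadiriNumerics.initial_constant_le :
    (4480 : ℝ) + 74172 / Real.log 3000175332800 ≤ 7062 := by
  have hl2a := Real.log_two_gt_d9
  have hl3 := KadiriNumerics.log_3_bounds
  have hl5 := KadiriNumerics.log_5_bounds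
  have hT : Real.log (3 * 10 ^ 12) = Real.log 3 + 12 * (Real.log 2 + Real.log 5) := by
    rw [Real.log_mul (by norm_num) (by norm_num), Real.log_pow, show (10 : ℝ) = 2 * 5 by norm_num,
      Real.log_mul (by norm_num) (by norm_num)]; push_cast; ring
  have hlow : (28.7296 : ℝ) ≤ Real.log 3000175332800 := by
    refine le_trans ?_ (Real.log_le_log (by norm_num) (by norm_num : (3 * 10 ^ 12 : ℝ) ≤ 3000175332800))
    rw [hT]; linarith [hl3.1, hl5.1]
  have h1 : (74172 : ℝ) / Real.log 3000175332800 ≤ 74172 / 28.7296 :=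
    div_le_div_of_nonneg_left (by norm_num) (by norm_num) hlow
  have h2 : (74172 : ℝ) / 28.7296 ≤ 2582 := by norm_num
  linarith

/-- **The Mossinghoff–Trudgian–Yang zero-free region at large height, from the numerical
verification of RH up to `3·10¹²`**: `ζ(σ + it) ≠ 0` for `t > 3·10¹²` and
`σ ≥ 1 − 1/(5.558691 log t)`. [cite: MossinghoffTrudgianYangRNT2024, Theorem 1.3 and §9] -/
theorem zero_free_region_mossinghoff_trudgian_yang_large_height_of_numerical_rh
    (h : platt_trudgian_numerical_rh) : zero_free_region_mossinghoff_trudgian_yang_large_height := by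
  have hRH := KadiriStrip.rh_up_to_of_numerical_rh h
  have hR0 : HasOpenClassicalZeroFreeRegion 7062 :=
    KadiriStrip.hasOpenRegion_initial (H := 3000175332800) (by norm_num) KadiriNumerics.initial_constant_le hRH
  have hR1 : HasOpenClassicalZeroFreeRegion 6.4 :=
    KadiriStrip.hasOpenRegion_of_stripEmpty (T₀ := 3 * 10 ^ 12) (H := 3000175332800) (by norm_num) (by norm_num)
      (KadiriNumerics.two_le_mul_log_two (by norm_num)) hR0 (KadiriNumerics.round_round1 hR0 hRH) hRH
  have hR2 : HasOpenClassicalZeroFreeRegion 5.66 :=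
    KadiriStrip.hasOpenRegion_of_stripEmpty (T₀ := 3 * 10 ^ 12) (H := 3000175332800) (by norm_num) (by norm_num)
      (KadiriNumerics.two_le_mul_log_two (by norm_num)) hR1 (KadiriNumerics.round_round2 hR1 hRH) hRH
  have hR3 : HasOpenClassicalZeroFreeRegion 5.57 :=
    KadiriStrip.hasOpenRegion_of_stripEmpty (T₀ := 3 * 10 ^ 12) (H := 3000175332800) (by norm_num) (by norm_num)
      (KadiriNumerics.two_le_mul_log_two (by norm_num)) hR2 (KadiriNumerics.round_round3 hR2 hRH) hRH
  exact zero_free_region_mossinghoff_trudgian_yang_large_height_of_kadiriStripEmpty hR3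
    (KadiriNumerics.round_round4 hR3 hRH)

end Literature.NumberTheory.LFunctions
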